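import Summits.CriticalPhenomena.SAWScalingLimit.Theorems.EventualTight.Negative.Snake3Component

/-!
# `EventualTight` — negative knowledge: boundary regularity is load-bearing (the dyadic snake)

Part 4 (conclusion): the depth `K δ` (first level with `r k ≤ 64 δ`), the honest endpoint approximation `a δ → 0`, `b δ → 5/8` (joined for `δ < 1/64`, probability laws), the FORCING theorem (every SAW traverses the fixed shell `D((1/2,0); 3/5, 7/10)` `K δ / 2` times, IVT across the walls), `Snake.escapes` (every compact set of curve classes gets mass `0` at meshes arbitrarily close to `0`), and the conclusions `eventualTight_false_without_jordan` (the `∃ δ₀` set form of stmt-1372 over general domains, stated inline) and `tightAlongMesh_false_without_jordan` (the along-the-mesh form of the twin stmt-1881).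

Support files for the crux `stmt-CriticalPhenomena-1372`
(`Summit.CriticalPhenomena.SAWScalingLimit.Theses.SAWRenewalTightness.EventualTight`; refuter `cdisprove`,
standing adversary; indexed work file
`Summits/CriticalPhenomena/SAWScalingLimit/Cruxes/EventualTight/Disproof.lean`, §5). The four parts
`Snake1Domain … Snake4Forcing` prove: over bounded open CONNECTED sets with two distinct marked FRONTIER
points (all the fields of `DobrushinDomain` except the Jordan boundary loop), the statement of the crux
is FALSE — so any proof of `EventualTight` must use the boundary loop (local connectivity of `∂Ω` at the
marked points). Everything proved, standard axioms. [folklore]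
-/

noncomputable section

open MeasureTheory Filter Topology Set Metric Complex
open Literature.Probability.RandomPlanarGeometry Literature.Probability.RandomPlanarGeometry.SAW
  Literature.Probability.LatticeModels
open scoped ENNReal NNReal unitInterval

namespace Summit.CriticalPhenomena.SAWScalingLimit.Theorems.EventualTight.Negative

open Summit.CriticalPhenomena.SAWScalingLimit.Theorems.ShellCrossingBound.Negative
  (exists_forall_not_hasTraversals_of_isCompact)
open Summit.CriticalPhenomena.SAWScalingLimit.Theorems.ShellCrossingBound.Negative.Forcing
  (meshPoint_vec vec_add_single_zero vec_add_single_one eq_vec exists_chain chain_lt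
    range_toCurve_subset toCurve_apply_one isProbabilityMeasure_law abs_im_sub_le_dist)

namespace Snake

/-! ### The depth `K δ`, the endpoints, and honesty of the approximation -/

/-- Snake bookkeeping (`exists_r_le`). [folklore] -/
theorem exists_r_le {δ : ℝ} (hδ : 0 < δ) : ∃ k, r k ≤ 64 * δ := by
  obtain ⟨k, hk⟩ := exists_pow_lt_of_lt_one (by positivity : (0:ℝ) < 64 * δ)
    (by norm_num : (1 / 2 : ℝ) < 1)
  exact ⟨k, hk.le⟩

/-- The depth `K δ`: the first level `k` with `r k ≤ 64 δ`. [folklore] -/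
def K (δ : ℝ) : ℕ := if h : 0 < δ then Nat.find (exists_r_le h) else 0

/-- Snake bookkeeping (`r_K_le`). [folklore] -/
theorem r_K_le {δ : ℝ} (hδ : 0 < δ) : r (K δ) ≤ 64 * δ := by
  rw [K, dif_pos hδ]; exact Nat.find_spec (exists_r_le hδ)

/-- The column of depth `K δ` is resolved: `16 δ < l (K δ)` (for `δ < 1/64`). [folklore] -/
theorem lt_l_K {δ : ℝ} (hδ : 0 < δ) (hδs : δ < 1 / 64) : 16 * δ < l (K δ) := by
  rw [K, dif_pos hδ]
  rcases Nat.eq_zero_or_pos (Nat.find (exists_r_le hδ)) with h0 | hpos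
  · rw [h0]; unfold l; rw [r_zero]; linarith
  · have hmin := Nat.find_min (exists_r_le hδ) (Nat.sub_one_lt_of_lt hpos)
    have hN : Nat.find (exists_r_le hδ) = (Nat.find (exists_r_le hδ) - 1) + 1 := by omega
    rw [hN]; unfold l; rw [r_succ]
    push Not at hmin
    linarith

/-- Snake bookkeeping (`lt_r_K`). [folklore] -/
theorem lt_r_K {δ : ℝ} (hδ : 0 < δ) (hδs : δ < 1 / 64) : 16 * δ < r (K δ) :=
  (lt_l_K hδ hδs).trans (l_lt_r _)

/-- If `64 δ < r n` then the depth exceeds `n`. [folklore] -/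
theorem lt_K_of {δ : ℝ} (hδ : 0 < δ) {n : ℕ} (hn : 64 * δ < r n) : n < K δ := by
  by_contra h
  have := r_antitone (not_lt.1 h)
  have := r_K_le hδ
  linarith

/-- The starting site `a δ`: first lattice abscissa of the column of depth `K δ`, row `1`. [folklore] -/
def aδ (δ : ℝ) : Site 2 := ![nxt δ (l (K δ)), 1]

/-- The target site `b δ`: the base point of `col 0`. [folklore] -/
def bδ (δ : ℝ) : Site 2 := v₀ δ

/-- Snake bookkeeping (`a_mem_col`). [folklore] -/
theorem a_mem_col {δ : ℝ} (hδ : 0 < δ) (hδs : δ < 1 / 64) :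
    (⟨δ * (nxt δ (l (K δ))), δ * ((1 : ℤ) : ℝ)⟩ : ℂ) ∈ col (K δ) := by
  obtain ⟨h1, h2⟩ := nxt_bounds hδ (l (K δ))
  have hr := lt_r_K hδ hδs
  have hw : l (K δ) + δ < r (K δ) := by unfold l at *; linarith
  exact ⟨⟨h1, by linarith⟩, one_mem_Ioo hδ (by linarith)⟩

/-- Snake bookkeeping (`meshPoint_aδ`). [folklore] -/
theorem meshPoint_aδ (δ : ℝ) : meshPoint δ (aδ δ) = ⟨δ * (nxt δ (l (K δ))), δ * ((1 : ℤ) : ℝ)⟩ := by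
  rw [aδ, meshPoint_vec]

/-- Snake bookkeeping (`aδ_mem_RS`). [folklore] -/
theorem aδ_mem_RS {δ : ℝ} (hδ : 0 < δ) (hδs : δ < 1 / 64) : aδ δ ∈ RS δ := by
  refine ⟨?_, ?_⟩
  · rw [mem_meshVertices_iff, meshPoint_aδ]
    exact col_subset_Ω _ (a_mem_col hδ hδs)
  · show (16 : ℤ) < nxt δ (l (K δ))
    obtain ⟨h1, -⟩ := nxt_bounds hδ (l (K δ))
    have hl := lt_l_K hδ hδs
    have : (16 : ℝ) < nxt δ (l (K δ)) := by
      by_contra h; push Not at h; nlinarith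
    exact_mod_cast this

/-- Snake bookkeeping (`norm_meshPoint_aδ_le`). [folklore] -/
theorem norm_meshPoint_aδ_le {δ : ℝ} (hδ : 0 < δ) :
    ‖meshPoint δ (aδ δ)‖ ≤ 66 * δ := by
  rw [meshPoint_aδ]
  obtain ⟨h1, h2⟩ := nxt_bounds hδ (l (K δ))
  have hl : l (K δ) ≤ r (K δ) := (l_lt_r _).le
  have hr := r_K_le hδ
  refine (norm_le_abs_re_add_abs_im _).trans ?_
  have hpos : 0 < δ * (nxt δ (l (K δ)) : ℝ) := (l_pos _).trans h1
  simp only [Int.cast_one, mul_one, abs_of_pos hpos, abs_of_pos hδ]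
  linarith

/-- Snake bookkeeping (`dist_meshPoint_bδ_le`). [folklore] -/
theorem dist_meshPoint_bδ_le {δ : ℝ} (hδ : 0 < δ) :
    dist (meshPoint δ (bδ δ)) ((5 / 8 : ℝ) : ℂ) ≤ 2 * δ := by
  rw [bδ, v₀, meshPoint_vec, Complex.dist_eq]
  obtain ⟨h1, h2⟩ := nxt_bounds hδ (5 / 8)
  refine (norm_le_abs_re_add_abs_im _).trans ?_
  simp only [sub_re, sub_im, ofReal_re, ofReal_im, Int.cast_one, mul_one, sub_zero, abs_of_pos hδ]
  unfold ib
  rw [abs_of_pos (by linarith)]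
  linarith

/-- Snake bookkeeping (`tendsto_aδ`). [folklore] -/
theorem tendsto_aδ : Tendsto (fun δ => meshPoint δ (aδ δ)) (𝓝[>] (0 : ℝ)) (𝓝 0) := by
  rw [Metric.tendsto_nhds]
  intro ε hε
  filter_upwards [Ioo_mem_nhdsGT (by positivity : 0 < ε / 67)] with δ hδ
  have hε' : δ < ε / 67 := hδ.2
  rw [dist_zero_right]
  linarith [norm_meshPoint_aδ_le hδ.1]

/-- Snake bookkeeping (`tendsto_bδ`). [folklore] -/
theorem tendsto_bδ : Tendsto (fun δ => meshPoint δ (bδ δ)) (𝓝[>] (0 : ℝ)) (𝓝 ((5 / 8 : ℝ) : ℂ)) := by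
  rw [Metric.tendsto_nhds]
  intro ε hε
  filter_upwards [Ioo_mem_nhdsGT (by positivity : 0 < ε / 3)] with δ hδ
  linarith [dist_meshPoint_bδ_le hδ.1, hδ.2]

/-- Snake bookkeeping (`eventually_reachable`). [folklore] -/
theorem eventually_reachable :
    ∀ᶠ δ in 𝓝[>] (0 : ℝ), (discreteDomainGraph Ω δ).Reachable (aδ δ) (bδ δ) := by
  filter_upwards [Ioo_mem_nhdsGT (by norm_num : (0:ℝ) < 1 / 64)] with δ hδ
  exact reachable_dd hδ.1 hδ.2 (aδ_mem_RS hδ.1 hδ.2) (v₀_mem_RS hδ.1 hδ.2)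

/-- Snake bookkeeping (`isProbabilityMeasure_law_snake`). [folklore] -/
theorem isProbabilityMeasure_law_snake {δ : ℝ} (hδ : 0 < δ) (hδs : δ < 1 / 64) :
    IsProbabilityMeasure (law Ω δ (aδ δ) (bδ δ)) :=
  isProbabilityMeasure_law isBounded_Ω hδ
    (reachable_dd hδ hδs (aδ_mem_RS hδ hδs) (v₀_mem_RS hδ hδs))

/-! ### Forcing: every SAW traverses the fixed shell `D((1/2, 0); 3/5, 7/10)` `K δ / 2` times -/

/-- Centre of the forcing shell. [folklore] -/
def x₀ : ℂ := ⟨1 / 2, 0⟩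

/-- Snake bookkeeping (`dist_le_of_low`). [folklore] -/
theorem dist_le_of_low {z : ℂ} (hre : 0 ≤ z.re ∧ z.re ≤ 1) (him : 0 ≤ z.im ∧ z.im ≤ 1 / 4) :
    dist z x₀ ≤ 3 / 5 := by
  rw [Complex.dist_eq]
  have h : ‖z - x₀‖ ^ 2 ≤ (3 / 5) ^ 2 := by
    rw [Complex.sq_norm, Complex.normSq_apply]
    simp only [sub_re, sub_im, x₀]
    nlinarith
  exact (pow_le_pow_iff_left₀ (norm_nonneg _) (by norm_num) two_ne_zero).1 h

/-- Snake bookkeeping (`le_dist_of_high`). [folklore] -/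
theorem le_dist_of_high {z : ℂ} (him : 3 / 4 ≤ z.im) : 7 / 10 ≤ dist z x₀ := by
  refine le_trans ?_ (abs_im_sub_le_dist z x₀)
  simp only [x₀, sub_zero]
  rw [abs_of_nonneg (by linarith)]
  linarith

/-- **Forcing.** For `0 < δ < 1/64`, EVERY self-avoiding walk of the discrete snake from `a δ`
to `b δ` traverses the fixed shell `D(x₀; 3/5, 7/10)` at least `K δ / 2` times: by the
intermediate value theorem its polyline crosses the `K δ` walls `re = m k`, `k < K δ`, in
decreasing order of `k`, and on a wall the ordinate is pinned alternately below `1/4` (even `k`) and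
above `3/4` (odd `k`). [folklore] -/
theorem forcing {δ : ℝ} (hδ : 0 < δ) (hδs : δ < 1 / 64) (γ : DomainSAW Ω δ (aδ δ) (bδ δ)) :
    (⟨γ.walk.toCurve (meshPoint δ)⟩ : Curve ℂ).HasTraversals (K δ / 2) x₀ (3 / 5) (7 / 10) := by
  set p : C(I, ℂ) := γ.walk.toCurve (meshPoint δ) with hp
  have hf : Continuous fun s : I => (p s).re := continuous_re.comp p.continuous
  have hcl : ∀ s, p s ∈ closure Ω := fun s => by
    refine range_toCurve_subset (meshPoint δ) (S := closure Ω) (fun x y hxy => ?_) γ.walk ?_ ⟨s, rfl⟩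
    · exact (meshGraph_adj_iff.1 (discreteDomainGraph_adj_iff.1 hxy).1).2
    · rw [meshPoint_aδ]; exact subset_closure (col_subset_Ω _ (a_mem_col hδ hδs))
  have hp0 : (p 0).re = δ * (nxt δ (l (K δ)) : ℝ) := by
    rw [hp, SimpleGraph.Walk.toCurve_apply_zero, meshPoint_aδ]
  have hp1 : (p 1).re = δ * (nxt δ (5 / 8) : ℝ) := by
    rw [hp, toCurve_apply_one, bδ, v₀, meshPoint_vec]; rfl
  set N : ℕ := K δ with hN
  rcases Nat.eq_zero_or_pos N with hN0 | hNpos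
  · rw [hN0]; exact Curve.hasTraversals_zero _ _ _ _
  -- the increasing levels `u j = m (N - 1 - j)`
  set u : ℕ → ℝ := fun j => m (N - 1 - j) with hu
  have hmono : ∀ j < N - 1, u j < u (j + 1) := fun j hj => m_antitone_strict (by omega)
  have hf0 : (p 0).re < u 0 := by
    rw [hp0]
    show δ * (nxt δ (l (K δ)) : ℝ) < m (N - 1 - 0)
    obtain ⟨-, h2⟩ := nxt_bounds hδ (l (K δ))
    have hr := lt_r_K hδ hδs
    have hK : N - 1 - 0 + 1 = K δ := by omega
    have hm : m (N - 1 - 0) = 9 / 8 * r (K δ) := by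
      rw [← hK, r_succ]; unfold m; ring
    rw [hm]; unfold l at h2 ⊢; linarith
  have hf1 : ∀ j ≤ N - 1, u j < (p 1).re := fun j _ => by
    rw [hp1]
    obtain ⟨h1, -⟩ := nxt_bounds hδ (5 / 8)
    have : u j ≤ m 0 := by
      show m (N - 1 - j) ≤ m 0
      unfold m; have := r_antitone (Nat.zero_le (N - 1 - j)); linarith
    unfold m at this; rw [r_zero] at this; linarith
  obtain ⟨t, ht, hlt⟩ := exists_chain hf u (N - 1) hmono hf0 hf1
  have hwin : ∀ j ≤ N - 1, (p (t j)).im ∈ cwin (N - 1 - j) := fun j hj =>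
    im_mem_cwin_of_re_eq_m (hcl _) (ht j hj)
  have hre01 : ∀ s, 0 ≤ (p s).re ∧ (p s).re ≤ 1 := fun s =>
    ⟨(re_im_of_mem_closure (hcl s)).1, (re_im_of_mem_closure (hcl s)).2.1⟩
  -- low / high dichotomy on a wall
  have hlow : ∀ j ≤ N - 1, Even (N - 1 - j) → dist (p (t j)) x₀ ≤ 3 / 5 := fun j hj he => by
    have hw := hwin j hj
    simp only [cwin, if_pos he] at hw
    exact dist_le_of_low (hre01 _) hw
  have hhigh : ∀ j ≤ N - 1, ¬ Even (N - 1 - j) → 7 / 10 ≤ dist (p (t j)) x₀ := fun j hj he => by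
    have hw := hwin j hj
    simp only [cwin, if_neg he] at hw
    exact le_dist_of_high hw.1
  refine ⟨fun i => t (2 * i), fun i => t (2 * i + 1), fun i => ?_, fun i j hij => ?_⟩
  · have hi : (i : ℕ) < N / 2 := i.isLt
    have h2i : 2 * (i : ℕ) + 1 ≤ N - 1 := by omega
    refine ⟨(chain_lt hlt (a := 2 * i) (b := 2 * i + 1) (by omega) h2i).le, ?_⟩
    have hsucc : N - 1 - 2 * (i : ℕ) = (N - 1 - (2 * i + 1)) + 1 := by omega
    by_cases he : Even (N - 1 - (2 * (i : ℕ) + 1))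
    · -- second wall low, first wall high
      have hne : ¬ Even (N - 1 - 2 * (i : ℕ)) := by rw [hsucc, Nat.even_add_one]; exact not_not.2 he
      exact Or.inr ⟨hhigh _ (by omega) hne, hlow _ h2i he⟩
    · have he' : Even (N - 1 - 2 * (i : ℕ)) := by rw [hsucc, Nat.even_add_one]; exact he
      exact Or.inl ⟨hlow _ (by omega) he', hhigh _ h2i he⟩
  · have hi := i.isLt; have hj := j.isLt
    have hij' : (i : ℕ) < j := hij
    exact chain_lt hlt (a := 2 * i + 1) (b := 2 * j) (by omega) (by omega)

/-- **Escape.** For every compact set of curve classes and every `δ₀ > 0` there is a mesh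
`δ ∈ (0, δ₀]` at which the snake SAW law is an honest probability measure giving the compact set
mass ZERO (all small meshes of depth `K δ > 2 k₀` do, `k₀` the traversal bound of the compact set). [folklore] -/
theorem escapes {𝒦 : Set (CurveClass ℂ)} (h𝒦 : IsCompact 𝒦) {δ₀ : ℝ} (hδ₀ : 0 < δ₀) :
    ∃ δ ∈ Set.Ioc (0 : ℝ) δ₀, IsProbabilityMeasure (law Ω δ (aδ δ) (bδ δ)) ∧
      law Ω δ (aδ δ) (bδ δ) ((fun γ : DomainSAW Ω δ (aδ δ) (bδ δ) => γ.curve) ⁻¹' 𝒦ᶜ) = 1 := by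
  obtain ⟨k₀, hk₀⟩ := exists_forall_not_hasTraversals_of_isCompact h𝒦 x₀
    (r := 3 / 5) (R := 7 / 10) (by norm_num)
  -- a mesh in `(0, δ₀]`, below `1/64`, of depth `K δ > 2 k₀`
  set δ : ℝ := min δ₀ (min (1 / 128) (r (2 * k₀) / 128)) with hδ_def
  have hr0 := r_pos (2 * k₀)
  have hδpos : 0 < δ := lt_min hδ₀ (lt_min (by norm_num) (by positivity))
  have hδle : δ ≤ δ₀ := min_le_left _ _
  have hδs : δ < 1 / 64 := by
    have : δ ≤ 1 / 128 := (min_le_right _ _).trans (min_le_left _ _); linarith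
  have hdepth : 2 * k₀ < K δ := lt_K_of hδpos (by
    have : δ ≤ r (2 * k₀) / 128 := (min_le_right _ _).trans (min_le_right _ _); linarith)
  haveI := isProbabilityMeasure_law_snake hδpos hδs
  refine ⟨δ, ⟨hδpos, hδle⟩, ‹_›, ?_⟩
  have hpre : (fun γ : DomainSAW Ω δ (aδ δ) (bδ δ) => γ.curve) ⁻¹' 𝒦ᶜ = univ := by
    refine eq_univ_of_forall fun γ => ?_
    show γ.curve ∉ 𝒦
    intro hγ
    exact hk₀ ⟨γ.walk.toCurve (meshPoint δ)⟩ hγ ((forcing hδpos hδs γ).of_le (by omega))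
  rw [hpre, measure_univ]

end Snake

/-! ### Boundary regularity is load-bearing: the crux over general bounded open connected sets is FALSE -/

/-- **Boundary regularity is load-bearing.** The statement of the crux `EventualTight` with the
Dobrushin (JORDAN) domain replaced by an arbitrary bounded open connected set with two distinct marked
FRONTIER points — i.e. keeping the fields `isOpen`, `isBounded`, `isConnected`, `pt_mem_frontier`,
`pt_injective` of `DobrushinDomain` and the three fields of `IsEndpointApprox`, and dropping only the
boundary LOOP (local connectivity of `∂Ω`) — is FALSE. Witness: the dyadic snake
`Snake.Ω` with marked frontier points `0` (at the accumulation of the columns) and `5/8`, and the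
honest endpoint approximation `Snake.aδ → 0`, `Snake.bδ → 5/8` (joined in `Ω_δ` for `δ < 1/64`, where
`Ω_δ` is identified by counting as everything of abscissa `> 16 δ`). Every SAW at mesh `δ` traverses
the FIXED shell `D((1/2,0); 3/5, 7/10)` at least `K δ / 2 → ∞` times (`Snake.forcing`), while on a
compact set of curve classes the number of traversals of a fixed shell is bounded
(`exists_forall_not_hasTraversals_of_isCompact`): for small `δ` the probability law gives the compact
set mass `0`. So ANY proof of `EventualTight` must use the Jordan boundary loop of `D` (local
connectivity of `∂Ω` at the marked points) — openness, boundedness, connectedness and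
`pt i ∈ frontier` do not suffice. [folklore] -/
theorem eventualTight_false_without_jordan :
    ¬ (∀ (Ω : Set ℂ) (p q : ℂ) (a b : ℝ → Site 2), IsOpen Ω → Bornology.IsBounded Ω → IsConnected Ω →
        p ∈ frontier Ω → q ∈ frontier Ω → p ≠ q →
        (∀ᶠ δ in 𝓝[>] (0 : ℝ), (discreteDomainGraph Ω δ).Reachable (a δ) (b δ)) →
        Tendsto (fun δ => meshPoint δ (a δ)) (𝓝[>] 0) (𝓝 p) →
        Tendsto (fun δ => meshPoint δ (b δ)) (𝓝[>] 0) (𝓝 q) →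
        ∃ δ₀ : ℝ, 0 < δ₀ ∧ IsTightMeasureSet
          ((fun δ => (law Ω δ (a δ) (b δ)).map (fun γ => γ.curve)) '' Set.Ioc 0 δ₀)) := by
  intro h
  obtain ⟨δ₀, hδ₀, hT⟩ := h Snake.Ω 0 ((5 / 8 : ℝ) : ℂ) Snake.aδ Snake.bδ Snake.isOpen_Ω
    Snake.isBounded_Ω Snake.isConnected_Ω Snake.zero_mem_frontier Snake.q_mem_frontier
    (by norm_num) Snake.eventually_reachable Snake.tendsto_aδ Snake.tendsto_bδ
  rw [isTightMeasureSet_iff_exists_isCompact_measure_compl_le] at hT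
  obtain ⟨K, hK, hμ⟩ := hT 2⁻¹ (by simp)
  obtain ⟨δ, hδ, _, h1⟩ := Snake.escapes hK hδ₀
  have hle := hμ _ ⟨δ, hδ, rfl⟩
  rw [Measure.map_apply (DomainSAW.measurable_of_top _) hK.isClosed.measurableSet.compl, h1] at hle
  exact absurd hle (by norm_num)

/-- The same witness refutes the ALONG-THE-MESH form (the shape of the twin stmt-1881,
`IsTightAlongMesh`) over bounded open connected sets: for every compact set of curve classes the
snake laws give it mass `0` at meshes arbitrarily close to `0`. [folklore] -/
theorem tightAlongMesh_false_without_jordan :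
    ¬ (∀ (Ω : Set ℂ) (p q : ℂ) (a b : ℝ → Site 2), IsOpen Ω → Bornology.IsBounded Ω →
        IsConnected Ω → p ∈ frontier Ω → q ∈ frontier Ω → p ≠ q →
        (∀ᶠ δ in 𝓝[>] (0 : ℝ), (discreteDomainGraph Ω δ).Reachable (a δ) (b δ)) →
        Tendsto (fun δ => meshPoint δ (a δ)) (𝓝[>] 0) (𝓝 p) →
        Tendsto (fun δ => meshPoint δ (b δ)) (𝓝[>] 0) (𝓝 q) →
        IsTightAlongMesh (fun δ (γ : DomainSAW Ω δ (a δ) (b δ)) => γ.curve)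
          (fun δ => law Ω δ (a δ) (b δ))) := by
  intro h
  obtain ⟨K, hK, hev⟩ := h Snake.Ω 0 ((5 / 8 : ℝ) : ℂ) Snake.aδ Snake.bδ Snake.isOpen_Ω
    Snake.isBounded_Ω Snake.isConnected_Ω Snake.zero_mem_frontier Snake.q_mem_frontier
    (by norm_num) Snake.eventually_reachable Snake.tendsto_aδ Snake.tendsto_bδ 2⁻¹ (by simp)
  obtain ⟨δ₁, hδ₁, hsub⟩ := mem_nhdsGT_iff_exists_Ioo_subset.1 hev
  have hδ₁pos : (0 : ℝ) < δ₁ := hδ₁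
  obtain ⟨δ, hδ, _, h1⟩ := Snake.escapes hK (half_pos hδ₁pos)
  have hle : (law Snake.Ω δ (Snake.aδ δ) (Snake.bδ δ))
      ((fun γ : DomainSAW Snake.Ω δ (Snake.aδ δ) (Snake.bδ δ) => γ.curve) ⁻¹' Kᶜ) ≤ 2⁻¹ :=
    hsub ⟨hδ.1, hδ.2.trans_lt (half_lt_self hδ₁pos)⟩
  rw [h1] at hle
  exact absurd hle (by norm_num)

end Summit.CriticalPhenomena.SAWScalingLimit.Theorems.EventualTight.Negative

end
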